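import Summits.QuantumFields.BalabanUV.T4Continuum.Spine.NE7.SpineRemainderRate
import Summits.QuantumFields.BalabanUV.T4Continuum.Spine.NE4.Targets

/-!
# Spine/NE4/TransportDominatesRate — (R64) RATE BUDGET DOWNSTREAM: NE4's rate `θ` is never the bottleneck of the spine's
# predicted continuum-limit rate; the PRINTED transport `ρ` of node U6 dominates (cell `pub-balaban-gaps`, seat ne4,
# generation 21; census item (R64) of `HOME/ne/NE4.md` §5; cross-row pointer to NE7's `Spine/NE7/SpineRemainderRate` (its R71))

HONEST FRAMING.  Bookkeeping for rung (B)+1 on ONE FIXED finite four-torus — NOT ℝ⁴, NOT infinite volume, NOT a mass gap, NOT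
Clay.  NE4 = `T4CouplingMatching.ScaleShiftRate` is NOT PRINTED ([Balaban1987RG1] p. 264) and NOT PROVED here; spine estimates proved
0∕9, unchanged.  [folklore] real analysis over the HYPOTHESIS SHAPES of `T4CauchySum` (`InjectedRate`, `delta`,
`MatchingModConstants`); nothing of Bałaban's is instantiated or asserted.  0 `def`, 0 sorry.

WHAT.  On the δ-road U2 → U6 → U0 the transported total of node U6 is the CONVOLUTION
`T4CauchySum.delta E ρ inj K = E·Σ_{j+n=K} inj K j·ρ^n` (:92): a discrepancy injected `j` steps below the cutoff is carried the
remaining `n = K − j` steps to the unit scale, contracting by `ρ` per step — `ρ = L^{−β}` being the PRINTED irrelevance exponent of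
[Balaban1988Convergent] Thm 2 (2.43), read for differences (row NE6), `0 ≤ β < 1`.  `T4CauchySum.delta_le` (:185) bounds it by
`E·C·(K+1)^{c+1}·max(θ,ρ)^K` under `InjectedRate C c θ inj`, and `Spine/NE7/SpineRemainderRate` turns that into the rate of approach of
the generating functions and the dictionary «`r^K` = the spacing power `a_K^{β′}`, `β′ = log_L(1∕r) < 1` iff `L⁻¹ < r`».  NE4 enters
`θ` (node U2's output is `Targets.U2Output D g₀ Cout θ = InjectedRate Cout 0 θ (disc of consecutive tuned runs)`, :83, from
`T4CouplingMatching.injectedRate_of_runs[_eventual]` :883 ∕ :902).  This file records, BY NAME, that NE4's rate is INVISIBLE downstream: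
* §1 the convolution EXACTLY: `(Σ_{j+n=K} θ^j ρ^n)·(θ − ρ) = θ^{K+1} − ρ^{K+1}` (`sum_antidiagonal_pow_mul_pow_mul_sub`); its `(0, K)`
  term alone gives `ρ^K ≤ Σ` (`transport_pow_le_sum_antidiagonal`) whatever `θ ≥ 0`; and for `0 ≤ θ < ρ` the logarithm of
  `T4CauchySum.sum_antidiagonal_pow_mul_pow_le` disappears: `Σ ≤ ρ∕(ρ−θ)·ρ^K` (`sum_antidiagonal_pow_mul_pow_le_of_lt`);
* §2 hence for the transported total: `E·inj K 0·ρ^K ≤ delta E ρ inj K` for every nonnegative profile (`delta_ge_head`) — the ONE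
  discrepancy injected at the cutoff scale, carried `K` steps, already costs `ρ^K`, so NO β-side rate can make `δ_K` decay faster than
  the transport (second floor `delta_ge_last`: the untransported unit-scale injection `E·inj K K` — invisible for NE4's geometric profile,
  but a NON-geometric remnant there, census (R62), sets the rate itself; `delta_ge_max` both); and `θ < ρ ⟹ delta E ρ inj K ≤
  E·C·(K+1)^c·ρ∕(ρ−θ)·ρ^K` (`delta_le_of_lt_transport`: exponent `c`, not `c+1`); for
  the extremal NE4-type profile `inj K j = C·θ^j` (an admissible `InjectedRate C 0 θ`, `injectedRate_geom`) the two-sided squeeze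
  `E·C·ρ^K ≤ δ_K ≤ E·C·ρ∕(ρ−θ)·ρ^K` (`delta_geom_two_sided`) and NO rate below `ρ` (`not_delta_geom_rate_below_transport`);
* §3 ON NE4's OWN ROAD: `U2Output D g₀ Cout θ` with `θ < ρ` ⟹ `δ_K ≤ E·Cout·ρ∕(ρ−θ)·ρ^K` — purely geometric AT THE TRANSPORT RATE, no
  logarithm (`delta_le_of_u2Output_lt_transport`); and the generating-function face through NE7's `abs_genFun_sub_lim_le_of_succ_pow_mul_geometric`
  (`abs_genFun_sub_lim_le_of_lt_transport`);
* §4 the lore inequality `θ_lore = L⁻² < L^{−β} = ρ` for every `β < 2` (`lore_rate_lt_transport`; with NE7's `inv_lt_rpow_neg_of_lt_one`,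
  `L⁻² < L⁻¹ < ρ` for the printed `β < 1`), and the spacing form `(L^{−β})^K = a_K^β` (`transport_pow_eq_spacing_rpow`): on NE4's road
  `δ_K ≤ E·Cout·ρ∕(ρ−θ)·a_K^β` — exponent `β` of (2.43) whatever `θ < ρ` (`delta_le_of_u2Output_spacing`).
UPSHOT for row NE4's classification (no status word moves): proving NE4 at its expected rate `θ = L⁻²`, or at ANY rate `θ ≤ ρ`, or
weakening it to rate exactly `ρ`, yields the SAME predicted spacing power `a^{β′}`, `β′ = β < 1` (up to the AF logarithm `(K+1)^c` of
the OTHER sources); NE4's GEOMETRIC form is needed only inside node U2's renewal (for CONVERGENCE the ℓ¹ ∕ remnant currencies of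
(R9′) ∕ (R62) suffice there too); for the RATE its VALUE is invisible below U2 whenever `θ ≤ ρ`, and the form re-enters only through the second
floor (`delta_ge_last`: a NON-geometric unit-scale remnant would set the rate itself — convergence kept, the power law in `a` lost).
LABELS: `θ = L⁻²` is LORE for Bałaban's β (MODEL-level kernel facts (R57)–(R60)); `β < 1` is the printed TYPE of (2.43) as booked by row NE6.

No status word moves: NE4 DEPENDENT (⇐ NE5 ∧ (AF-0r)); NOT IN PRINT; NOT PROVED; 0∕9.  HONEST DEPENDENCY (cell, verbatim): continuum
YM on T⁴ ⇐ BetaPertH ∧ nine spine estimates (0∕9 proved); BetaPertH ⇐ (D1) ∧ (D4) ∧ CAP+tail.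

References (TYPES only): [Balaban1987RG1] = T. Bałaban, Commun. Math. Phys. **109** (1987) 249–301, (0.20) p. 256, p. 264;
[Balaban1988Convergent] = T. Bałaban, Commun. Math. Phys. **119** (1988) 243–285, Thm 2 (2.43) p. 263.
-/

noncomputable section

namespace Summit.QuantumFields.BalabanUV.T4Continuum.Spine.NE4.TransportDominatesRate

open Finset Filter Topology
open Literature.MathematicalPhysics.QuantumFieldTheory.Balaban1983to89
open Literature.MathematicalPhysics.QuantumFieldTheory.Balaban1983to89.T4CauchySum
open Literature.MathematicalPhysics.QuantumFieldTheory.Balaban1983to89.T4Continuum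
open Summit.QuantumFields.BalabanUV.T4Continuum.Spine.NE7 (abs_genFun_sub_lim_le_of_succ_pow_mul_geometric)

/-! ## §1 The convolution of two geometric rates, exactly and at the transport rate -/

/-- **THE CONVOLUTION EXACTLY**: `(Σ_{j+n=K} θ^j ρ^n)·(θ − ρ) = θ^{K+1} − ρ^{K+1}` (so for `θ ≠ ρ` the sum is
`(ρ^{K+1} − θ^{K+1})∕(ρ − θ)`, and `(K+1)·θ^K` at `θ = ρ`). [folklore] -/
theorem sum_antidiagonal_pow_mul_pow_mul_sub (θ ρ : ℝ) (K : ℕ) :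
    (∑ p ∈ antidiagonal K, θ ^ p.1 * ρ ^ p.2) * (θ - ρ) = θ ^ (K + 1) - ρ ^ (K + 1) := by
  rw [Nat.sum_antidiagonal_eq_sum_range_succ_mk]
  have e : ∑ k ∈ range K.succ, θ ^ k * ρ ^ (K - k) = ∑ i ∈ range (K + 1), θ ^ i * ρ ^ (K + 1 - 1 - i) := by
    refine Finset.sum_congr rfl fun i _ => ?_
    rw [Nat.add_sub_cancel]
  rw [e]
  exact (Commute.all θ ρ).geom_sum₂_mul (K + 1)

/-- **THE TRANSPORT TERM ALONE**: `ρ^K ≤ Σ_{j+n=K} θ^j ρ^n` for `θ, ρ ≥ 0` — the `(0, K)` term: the discrepancy injected AT the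
cutoff scale and carried all `K` steps. [folklore] -/
theorem transport_pow_le_sum_antidiagonal {θ ρ : ℝ} (hθ : 0 ≤ θ) (hρ : 0 ≤ ρ) (K : ℕ) :
    ρ ^ K ≤ ∑ p ∈ antidiagonal K, θ ^ p.1 * ρ ^ p.2 := by
  have h0 : ((0, K) : ℕ × ℕ) ∈ antidiagonal K := by simp
  have := Finset.single_le_sum (f := fun p : ℕ × ℕ => θ ^ p.1 * ρ ^ p.2)
    (fun p _ => mul_nonneg (pow_nonneg hθ _) (pow_nonneg hρ _)) h0
  simpa using this

/-- The source term alone, symmetrically: `θ^K ≤ Σ_{j+n=K} θ^j ρ^n` (the `(K, 0)` term). [folklore] -/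
theorem source_pow_le_sum_antidiagonal {θ ρ : ℝ} (hθ : 0 ≤ θ) (hρ : 0 ≤ ρ) (K : ℕ) :
    θ ^ K ≤ ∑ p ∈ antidiagonal K, θ ^ p.1 * ρ ^ p.2 := by
  have h0 : ((K, 0) : ℕ × ℕ) ∈ antidiagonal K := by simp
  have := Finset.single_le_sum (f := fun p : ℕ × ℕ => θ ^ p.1 * ρ ^ p.2)
    (fun p _ => mul_nonneg (pow_nonneg hθ _) (pow_nonneg hρ _)) h0
  simpa using this

/-- Two-sided squeeze with `T4CauchySum.sum_antidiagonal_pow_mul_pow_le`: `max(θ,ρ)^K ≤ Σ_{j+n=K} θ^j ρ^n ≤ (K+1)·max(θ,ρ)^K`.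
[folklore] -/
theorem max_pow_le_sum_antidiagonal {θ ρ : ℝ} (hθ : 0 ≤ θ) (hρ : 0 ≤ ρ) (K : ℕ) :
    (max θ ρ) ^ K ≤ ∑ p ∈ antidiagonal K, θ ^ p.1 * ρ ^ p.2 ∧
      ∑ p ∈ antidiagonal K, θ ^ p.1 * ρ ^ p.2 ≤ ((K : ℝ) + 1) * (max θ ρ) ^ K := by
  refine ⟨?_, sum_antidiagonal_pow_mul_pow_le hθ hρ K⟩
  rcases le_total θ ρ with h | h
  · rw [max_eq_right h]; exact transport_pow_le_sum_antidiagonal hθ hρ K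
  · rw [max_eq_left h]; exact source_pow_le_sum_antidiagonal hθ hρ K

/-- **NO LOGARITHM BELOW THE TRANSPORT RATE**: for `0 ≤ θ < ρ`, `Σ_{j+n=K} θ^j ρ^n ≤ ρ∕(ρ−θ)·ρ^K` — the factor `(K+1)` of
`T4CauchySum.sum_antidiagonal_pow_mul_pow_le` is an artefact of `θ = ρ`. [folklore] -/
theorem sum_antidiagonal_pow_mul_pow_le_of_lt {θ ρ : ℝ} (hθ : 0 ≤ θ) (hθρ : θ < ρ) (K : ℕ) :
    ∑ p ∈ antidiagonal K, θ ^ p.1 * ρ ^ p.2 ≤ ρ / (ρ - θ) * ρ ^ K := by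
  have hρ : 0 < ρ := hθ.trans_lt hθρ
  have hq0 : 0 ≤ θ / ρ := div_nonneg hθ hρ.le
  have hq1 : θ / ρ < 1 := (div_lt_one hρ).mpr hθρ
  have hterm : ∀ p ∈ antidiagonal K, θ ^ p.1 * ρ ^ p.2 = ρ ^ K * (θ / ρ) ^ p.1 := by
    intro p hp
    have hK : p.1 + p.2 = K := mem_antidiagonal.mp hp
    have hρk : ρ ^ p.1 ≠ 0 := pow_ne_zero _ hρ.ne'
    rw [← hK, pow_add, div_pow, mul_comm (ρ ^ p.1 * ρ ^ p.2), div_mul_eq_mul_div, eq_div_iff hρk]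
    ring
  rw [Finset.sum_congr rfl hterm, ← Finset.mul_sum, Nat.sum_antidiagonal_eq_sum_range_succ_mk]
  have hgeom : ∑ k ∈ range K.succ, (θ / ρ) ^ k ≤ (1 - θ / ρ)⁻¹ := by
    have hs := summable_geometric_of_lt_one hq0 hq1
    calc ∑ k ∈ range K.succ, (θ / ρ) ^ k ≤ ∑' k, (θ / ρ) ^ k := hs.sum_le_tsum _ fun k _ => pow_nonneg hq0 k
      _ = (1 - θ / ρ)⁻¹ := tsum_geometric_of_lt_one hq0 hq1
  have hinv : (1 - θ / ρ)⁻¹ = ρ / (ρ - θ) := by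
    rw [one_sub_div hρ.ne', inv_div]
  calc ρ ^ K * ∑ k ∈ range K.succ, (θ / ρ) ^ k ≤ ρ ^ K * (1 - θ / ρ)⁻¹ :=
        mul_le_mul_of_nonneg_left hgeom (pow_nonneg hρ.le K)
    _ = ρ / (ρ - θ) * ρ ^ K := by rw [hinv, mul_comm]

/-! ## §2 The transported total of node U6: the transport is the floor, and no logarithm below it -/

/-- **THE TRANSPORT IS THE FLOOR**: for a nonnegative injected profile, `E·inj K 0·ρ^K ≤ delta E ρ inj K` (`E, ρ ≥ 0`) — the one
discrepancy injected at the cutoff scale, carried `K` steps.  Whatever rate the β-side (NE4) or any other source has in `j`, the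
transported total cannot decay faster than `ρ^K` unless the cutoff-scale injection itself vanishes. [folklore] -/
theorem delta_ge_head {E ρ : ℝ} {inj : ℕ → ℕ → ℝ} (hnn : ∀ K j, j ≤ K → 0 ≤ inj K j) (hE : 0 ≤ E) (hρ : 0 ≤ ρ) (K : ℕ) :
    E * inj K 0 * ρ ^ K ≤ delta E ρ inj K := by
  unfold delta
  rw [mul_assoc]
  refine mul_le_mul_of_nonneg_left ?_ hE
  have h0 : ((0, K) : ℕ × ℕ) ∈ antidiagonal K := by simp
  have := Finset.single_le_sum (f := fun p : ℕ × ℕ => inj K p.1 * ρ ^ p.2)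
    (fun p hp => mul_nonneg (hnn K p.1 (by have := mem_antidiagonal.mp hp; omega)) (pow_nonneg hρ _)) h0
  simpa using this

/-- **THE SECOND FLOOR — THE UNTRANSPORTED UNIT-SCALE INJECTION**: `E·inj K K ≤ delta E ρ inj K` (the `(K, 0)` term: the
discrepancy injected at the LAST step is not contracted at all).  For NE4's geometric profile this floor is `C·θ^K ≤ C·ρ^K` when
`θ ≤ ρ` — invisible —, but for a profile weakened by a NON-geometric remnant `r_K` at `j = K` (census (R62): summable run-length
remnants, which still give CONVERGENCE) it is `r_K` itself: the remnant, not the transport, then sets the δ-road's RATE. [folklore] -/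
theorem delta_ge_last {E ρ : ℝ} {inj : ℕ → ℕ → ℝ} (hnn : ∀ K j, j ≤ K → 0 ≤ inj K j) (hE : 0 ≤ E) (hρ : 0 ≤ ρ) (K : ℕ) :
    E * inj K K ≤ delta E ρ inj K := by
  unfold delta
  refine mul_le_mul_of_nonneg_left ?_ hE
  have h0 : ((K, 0) : ℕ × ℕ) ∈ antidiagonal K := by simp
  have := Finset.single_le_sum (f := fun p : ℕ × ℕ => inj K p.1 * ρ ^ p.2)
    (fun p hp => mul_nonneg (hnn K p.1 (by have := mem_antidiagonal.mp hp; omega)) (pow_nonneg hρ _)) h0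
  simpa using this

/-- Both floors at once: `E·max(inj K 0·ρ^K, inj K K) ≤ delta E ρ inj K`. [folklore] -/
theorem delta_ge_max {E ρ : ℝ} {inj : ℕ → ℕ → ℝ} (hnn : ∀ K j, j ≤ K → 0 ≤ inj K j) (hE : 0 ≤ E) (hρ : 0 ≤ ρ) (K : ℕ) :
    E * max (inj K 0 * ρ ^ K) (inj K K) ≤ delta E ρ inj K := by
  rcases le_total (inj K 0 * ρ ^ K) (inj K K) with h | h
  · rw [max_eq_right h]; exact delta_ge_last hnn hE hρ K
  · rw [max_eq_left h, ← mul_assoc]; exact delta_ge_head hnn hE hρ K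

/-- The same floor under the spine's hypothesis shape (nonnegativity is part of `InjectedRate`). [folklore] -/
theorem delta_ge_head_of_injectedRate {C θ E ρ : ℝ} {c : ℕ} {inj : ℕ → ℕ → ℝ} (hinj : InjectedRate C c θ inj)
    (hE : 0 ≤ E) (hρ : 0 ≤ ρ) (K : ℕ) : E * inj K 0 * ρ ^ K ≤ delta E ρ inj K :=
  delta_ge_head (fun K j hj => (hinj K j hj).1) hE hρ K

/-- **NO LOGARITHM BELOW THE TRANSPORT RATE**: under `InjectedRate C c θ inj` with `0 ≤ θ < ρ` and `E ≥ 0`,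
`delta E ρ inj K ≤ E·C·(K+1)^c·ρ∕(ρ−θ)·ρ^K` — exponent `c` (the AF logarithm of the sources only), not the `c+1` of
`T4CauchySum.delta_le`. [folklore] -/
theorem delta_le_of_lt_transport {C θ E ρ : ℝ} {c : ℕ} {inj : ℕ → ℕ → ℝ} (hinj : InjectedRate C c θ inj) (hE : 0 ≤ E)
    (hθ : 0 ≤ θ) (hθρ : θ < ρ) (K : ℕ) :
    delta E ρ inj K ≤ E * C * ((K : ℝ) + 1) ^ c * (ρ / (ρ - θ)) * ρ ^ K := by
  have hρ : 0 ≤ ρ := hθ.trans hθρ.le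
  unfold delta
  have hsum : ∑ p ∈ antidiagonal K, inj K p.1 * ρ ^ p.2
      ≤ ∑ p ∈ antidiagonal K, C * ((K : ℝ) + 1) ^ c * (θ ^ p.1 * ρ ^ p.2) := by
    refine Finset.sum_le_sum fun p hp => ?_
    have hj : p.1 ≤ K := by have := mem_antidiagonal.mp hp; omega
    calc inj K p.1 * ρ ^ p.2 ≤ (C * ((K : ℝ) + 1) ^ c * θ ^ p.1) * ρ ^ p.2 :=
          mul_le_mul_of_nonneg_right (hinj K p.1 hj).2 (pow_nonneg hρ _)
      _ = C * ((K : ℝ) + 1) ^ c * (θ ^ p.1 * ρ ^ p.2) := by ring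
  have hC : 0 ≤ C * ((K : ℝ) + 1) ^ c := hinj.const_nonneg K
  calc E * ∑ p ∈ antidiagonal K, inj K p.1 * ρ ^ p.2
      ≤ E * ∑ p ∈ antidiagonal K, C * ((K : ℝ) + 1) ^ c * (θ ^ p.1 * ρ ^ p.2) :=
        mul_le_mul_of_nonneg_left hsum hE
    _ = E * (C * ((K : ℝ) + 1) ^ c * ∑ p ∈ antidiagonal K, θ ^ p.1 * ρ ^ p.2) := by
        congr 1
        rw [Finset.mul_sum]
    _ ≤ E * (C * ((K : ℝ) + 1) ^ c * (ρ / (ρ - θ) * ρ ^ K)) :=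
        mul_le_mul_of_nonneg_left
          (mul_le_mul_of_nonneg_left (sum_antidiagonal_pow_mul_pow_le_of_lt hθ hθρ K) hC) hE
    _ = E * C * ((K : ℝ) + 1) ^ c * (ρ / (ρ - θ)) * ρ ^ K := by ring

/-- The extremal NE4-type profile `inj K j = C·θ^j` (`C, θ ≥ 0`) is an admissible injected rate with AF exponent `0` — the shape of
node U2's output `Targets.U2Output` ∕ `T4CouplingMatching.injectedRate_of_runs`. [folklore] -/
theorem injectedRate_geom {C θ : ℝ} (hC : 0 ≤ C) (hθ : 0 ≤ θ) : InjectedRate C 0 θ (fun _ j => C * θ ^ j) := by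
  intro K j _
  refine ⟨mul_nonneg hC (pow_nonneg hθ j), ?_⟩
  simp

/-- **TWO-SIDED, FOR THE EXTREMAL PROFILE**: with `inj K j = C·θ^j`, `0 ≤ θ < ρ`, `C, E ≥ 0`:
`E·C·ρ^K ≤ delta E ρ inj K ≤ E·C·ρ∕(ρ−θ)·ρ^K` — the transported total IS geometric at the TRANSPORT rate, with constants
independent of `K`; NE4's `θ` moves only the prefactor `ρ∕(ρ−θ) ∈ ]1, ∞[`. [folklore] -/
theorem delta_geom_two_sided {C θ E ρ : ℝ} (hC : 0 ≤ C) (hE : 0 ≤ E) (hθ : 0 ≤ θ) (hθρ : θ < ρ) (K : ℕ) :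
    E * C * ρ ^ K ≤ delta E ρ (fun _ j => C * θ ^ j) K ∧
      delta E ρ (fun _ j => C * θ ^ j) K ≤ E * C * (ρ / (ρ - θ)) * ρ ^ K := by
  have hρ : 0 ≤ ρ := hθ.trans hθρ.le
  refine ⟨?_, ?_⟩
  · have h := delta_ge_head_of_injectedRate (injectedRate_geom hC hθ) hE hρ K
    simpa using h
  · have h := delta_le_of_lt_transport (injectedRate_geom hC hθ) hE hθ hθρ K
    simpa using h

/-- **NO RATE BELOW THE TRANSPORT**: for the extremal profile with `E, C > 0`, `θ ≥ 0`, `ρ > 0`, and ANY `0 ≤ r < ρ`, there is NO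
constant `D` with `delta E ρ inj K ≤ D·r^K` for all `K` — however small NE4's `θ` (even `θ = 0`: the β-side forgetting the cutoff in
ONE step), the spine's transported total decays no faster than `ρ^K`. [folklore] -/
theorem not_delta_geom_rate_below_transport {C θ E ρ r : ℝ} (hC : 0 < C) (hE : 0 < E) (hθ : 0 ≤ θ) (hρ : 0 < ρ)
    (hr : 0 ≤ r) (hrρ : r < ρ) :
    ¬ ∃ D : ℝ, ∀ K : ℕ, delta E ρ (fun _ j => C * θ ^ j) K ≤ D * r ^ K := by
  rintro ⟨D, hD⟩
  have hq0 : 0 ≤ r / ρ := div_nonneg hr hρ.le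
  have hq1 : r / ρ < 1 := (div_lt_one hρ).mpr hrρ
  have hle : ∀ K : ℕ, E * C ≤ D * (r / ρ) ^ K := by
    intro K
    have h0 := delta_ge_head (inj := fun _ j => C * θ ^ j) (fun K j _ => mul_nonneg hC.le (pow_nonneg hθ j))
      hE.le hρ.le K
    have h1 : E * C * ρ ^ K ≤ D * r ^ K := by
      have := h0.trans (hD K)
      simpa using this
    rw [div_pow, ← mul_div_assoc, le_div_iff₀ (pow_pos hρ K)]
    exact h1
  have hlim : Tendsto (fun K : ℕ => D * (r / ρ) ^ K) atTop (𝓝 (D * 0)) :=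
    (tendsto_pow_atTop_nhds_zero_of_lt_one hq0 hq1).const_mul D
  rw [mul_zero] at hlim
  have : E * C ≤ 0 := ge_of_tendsto' hlim hle
  exact absurd this (not_le.mpr (mul_pos hE hC))

/-! ## §3 On NE4's own road: node U2's output below the transport rate, and the generating-function face -/

universe u

variable {F : T4Family} {G : Type u} [GaugeGroup G] [MeasurableSpace G] [HaarData G]

/-- **NODE U2's OUTPUT BELOW THE TRANSPORT RATE ⟹ A PURELY GEOMETRIC SOURCE TERM AT RATE ρ, NO LOGARITHM.**  If node U2 delivers
its output on Bałaban's data at a β-side rate `θ` (`Targets.U2Output D g₀ Cout θ`, e.g. from NE4 + companions by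
`Targets.u2Output_of_u2Inputs`) with `0 ≤ θ < ρ`, then the transported coupling-source total obeys
`delta E ρ (disc of consecutive tuned runs) K ≤ E·Cout·ρ∕(ρ−θ)·ρ^K` (`E ≥ 0`).  HYPOTHESES ONLY. [cite: Balaban1987RG1, (0.20) p.256] -/
theorem delta_le_of_u2Output_lt_transport (D : FiniteEpsData F G) {g₀ : ℕ → ℝ} {Cout θ E ρ : ℝ}
    (h : U2Output D g₀ Cout θ) (hE : 0 ≤ E) (hθ : 0 ≤ θ) (hθρ : θ < ρ) (K : ℕ) :
    delta E ρ (fun K j => T4CouplingMatching.disc (runFlow D g₀ K) (runFlow D g₀ (K + 1)) j) K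
      ≤ E * Cout * (ρ / (ρ - θ)) * ρ ^ K := by
  have h' := delta_le_of_lt_transport (show InjectedRate Cout 0 θ _ from h) hE hθ hθρ K
  simpa using h'

/-- **THE GENERATING-FUNCTION FACE BELOW THE TRANSPORT RATE** (through NE7's `abs_genFun_sub_lim_le_of_succ_pow_mul_geometric`): under
`MatchingModConstants vol l₀ (delta E ρ inj) Z` and `InjectedRate C c θ inj` with `0 ≤ θ < ρ < 1`, `E ≥ 0`, uniformly on `|t| ≤ l₀`,
`|genFun Z K t − genFunLim Z t| ≤ 2·vol·(E·C·ρ∕(ρ−θ))·(K+1)^c·ρ^K·Σ_{j≥0} (j+1)^c ρ^j` — rate `(K+1)^c·ρ^K`: the transport rate with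
the sources' AF logarithm only. [bookkeeping] -/
theorem abs_genFun_sub_lim_le_of_lt_transport {vol l₀ C θ E ρ : ℝ} {c : ℕ} {inj : ℕ → ℕ → ℝ} {Z : ℕ → ℝ → ℝ}
    (h : MatchingModConstants vol l₀ (delta E ρ inj) Z) (hinj : InjectedRate C c θ inj) (hE : 0 ≤ E)
    (hθ : 0 ≤ θ) (hθρ : θ < ρ) (hρ1 : ρ < 1) (hvol : 0 < vol) (hl₀ : 0 ≤ l₀) {t : ℝ} (ht : |t| ≤ l₀) (K : ℕ) :
    |genFun Z K t - genFunLim Z t|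
      ≤ 2 * vol * ((E * C * (ρ / (ρ - θ))) * ((((K : ℕ) : ℝ) + 1) ^ c * ρ ^ K) *
          ∑' j : ℕ, ((((j : ℕ) : ℝ) + 1) ^ c * ρ ^ j)) := by
  have hρ0 : 0 ≤ ρ := hθ.trans hθρ.le
  have hC : 0 ≤ C := by simpa using hinj.const_nonneg 0
  have hD : 0 ≤ E * C * (ρ / (ρ - θ)) := mul_nonneg (mul_nonneg hE hC) (div_nonneg hρ0 (sub_pos.mpr hθρ).le)
  have hle : ∀ K : ℕ, delta E ρ inj K ≤ E * C * (ρ / (ρ - θ)) * ((((K : ℕ) : ℝ) + 1) ^ c * ρ ^ K) := fun K =>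
    (delta_le_of_lt_transport hinj hE hθ hθρ K).trans_eq (by ring)
  exact abs_genFun_sub_lim_le_of_succ_pow_mul_geometric h hvol hl₀ hD hρ0 hρ1 hle ht K

/-! ## §4 The lore inequality: NE4's expected rate lies below the printed transport -/

/-- **`θ_lore = L⁻² < L^{−β} = ρ` for every `β < 2`** (`L > 1`); with the printed `β < 1` of (2.43) also `L⁻² < L⁻¹ < ρ`
(NE7's `SpineRemainderRate.inv_lt_rpow_neg_of_lt_one`).  LORE label: `θ = L⁻²` is the expected, not a proved, rate of NE4 (MODEL-level
kernel facts (R57)–(R60) of the census); `β` is the printed TYPE of the (2.43) exponent as booked by row NE6. [folklore] -/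
theorem lore_rate_lt_transport {L β : ℝ} (hL : 1 < L) (hβ : β < 2) : (L ^ 2)⁻¹ < L ^ (-β) := by
  have hL0 : 0 < L := zero_lt_one.trans hL
  calc (L ^ 2)⁻¹ = (L ^ (2 : ℝ))⁻¹ := by rw [Real.rpow_two]
    _ = L ^ (-(2 : ℝ)) := (Real.rpow_neg hL0.le 2).symm
    _ < L ^ (-β) := Real.rpow_lt_rpow_of_exponent_lt hL (by linarith)

/-- … so at the lore values the hypotheses `0 ≤ θ < ρ < 1` of §2–§3 are met: for `L > 1` and `0 < β < 2`,
`0 ≤ (L^2)⁻¹ ∧ (L^2)⁻¹ < L^{−β} ∧ L^{−β} < 1`. [folklore] -/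
theorem lore_regime {L β : ℝ} (hL : 1 < L) (hβ0 : 0 < β) (hβ : β < 2) :
    0 ≤ (L ^ 2)⁻¹ ∧ (L ^ 2)⁻¹ < L ^ (-β) ∧ L ^ (-β) < 1 := by
  have hL0 : 0 < L := zero_lt_one.trans hL
  refine ⟨inv_nonneg.mpr (pow_nonneg hL0.le 2), lore_rate_lt_transport hL hβ, ?_⟩
  exact Real.rpow_lt_one_of_one_lt_of_neg hL (by linarith)

/-- **GEOMETRIC IN THE STEPS = A POWER OF THE SPACING, EXACTLY AT THE TRANSPORT RATE**: `(L^{−β})^K = (a_K)^β` with `a_K = (L^K)⁻¹` the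
lattice spacing of the run with `K` steps (`L > 0`) — the special case `r = ρ = L^{−β}` of NE7's dictionary `SpineRemainderRate.pow_eq_spacing_rpow`
(there `β′ = log_L(1∕r)`; here the exponent is `β` itself, no logarithm to evaluate). [folklore] -/
theorem transport_pow_eq_spacing_rpow {L : ℝ} (hL : 0 < L) (β : ℝ) (K : ℕ) :
    (L ^ (-β)) ^ K = ((L ^ K)⁻¹) ^ β := by
  rw [Real.inv_rpow (pow_nonneg hL.le K), ← Real.rpow_neg (pow_nonneg hL.le K), ← Real.rpow_natCast (L ^ (-β)) K,
    ← Real.rpow_natCast L K, ← Real.rpow_mul hL.le, ← Real.rpow_mul hL.le, mul_comm]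

/-- **NE4's ROAD IN THE SPACING**: with the transport written `ρ = L^{−β}` (`L > 1`, `β > 0`) and a β-side rate `0 ≤ θ < L^{−β}`, node U2's
output `U2Output D g₀ Cout θ` gives the transported coupling-source total as a PURE POWER OF THE LATTICE SPACING,
`δ_K ≤ E·Cout·ρ∕(ρ−θ)·(a_K)^β`, `a_K = (L^K)⁻¹` — exponent `β` of (2.43), whatever NE4's `θ` below `ρ`.  HYPOTHESES ONLY; `β < 1` printed TYPE,
`θ` UNPRINTED. [cite: Balaban1988Convergent, Thm 2 (2.43) p.263] -/
theorem delta_le_of_u2Output_spacing (D : FiniteEpsData F G) {g₀ : ℕ → ℝ} {Cout θ E L β : ℝ}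
    (h : U2Output D g₀ Cout θ) (hE : 0 ≤ E) (hθ : 0 ≤ θ) (hL : 1 < L) (hθρ : θ < L ^ (-β)) (K : ℕ) :
    delta E (L ^ (-β)) (fun K j => T4CouplingMatching.disc (runFlow D g₀ K) (runFlow D g₀ (K + 1)) j) K
      ≤ E * Cout * (L ^ (-β) / (L ^ (-β) - θ)) * ((L ^ K)⁻¹) ^ β := by
  rw [← transport_pow_eq_spacing_rpow (zero_lt_one.trans hL) β K]
  exact delta_le_of_u2Output_lt_transport D h hE hθ hθρ K

end Summit.QuantumFields.BalabanUV.T4Continuum.Spine.NE4.TransportDominatesRate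

end
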